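import Summits.NavierStokesRegularity.NavierStokesRegularity.Theses.AxisymmetricExtremality
import Literature.Analysis.FluidPDE.SobolevWeakGradient
import Literature.Analysis.FluidPDE.ParabolicTenThirds
import HarnessLib

/-!
# Seregin 2020, Lemma 2.2 (after Nazarov–Uraltseva 2012): the mixed-norm parabolic embedding
# of the energy class `𝒱 = L^∞_t L²_x ∩ L²_t Ḣ¹_x ⊂ L^l_t L^r_x`, `3/r + 2/l ≥ 3/2`

Helper toward the stub `stub_seregin2020TypeII` of the crux `AxisymmetricKatoGlobal` (= the named
fact `Literature.Analysis.FluidPDE.Seregin2020_axisymmetricSingularPoint_typeII`, G. Seregin,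
Anal. Math. Phys. 10 (2020) Paper 46 = arXiv:2006.04140, Thm 2.1), by now reduced to Lemma 2.2 of
the paper, whose printed proof is Nazarov–Uraltseva, St. Petersburg Math. J. 23 (2012), §3 and
Lemma 4.2. The Moser local-maximum estimate there (Lemma 3.1, (3.3)–(3.5)) controls the drift
term by Hölder's inequality and "the embedding theorem [LSU]"
`‖vζ‖_{r,l,Q} ≤ C₉ R^{n/r+2/l-n/2} ‖vζ‖_{𝒱(Q)}`, `‖f‖²_𝒱 = ‖f‖²_{2,∞,Q} + ‖Df‖²_{2,2,Q}` (§1), for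
the pairs `(r, l)`, `n/2 ≤ n/r + 2/l`, defined by `1/(2s) + 1/q + (2-1/s)/r = 1`,
`1/(2s) + 1/ℓ + (2-1/s)/l = 1`, `1/s = 1 - n/(2q) - 1/ℓ` (drift `b ∈ L_{q,ℓ}`), and for
`r = l = 2(n+2)/n` in the iteration (3.7). For `n = 3` and the two drifts of Seregin's Lemma 2.2
(N–U Remark 5): `u ∈ L_{3,4}` gives `s = 4`, `(r, l) = (42/13, 14/5)`; `b̂ = 2x'/|x'|² ∈ L_{q,∞}`,
`3/2 < q < 2`, gives `l = 2`, `14/3 < r < 6`; the iteration uses `(10/3, 10/3)`. All of them have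
`2 ≤ r ≤ 6` and `3/r + 2/l ≥ 3/2`.

This file proves the embedding for EVERY such pair, in the `[0, ∞]`-valued slice-bound
vocabulary of the tree's `LeiZhang2011.lintegral_rpow_tenThirds_le_of_slice_bounds` (which is the
case `(10/3, 10/3)`): if for `ν`-a.e. `s` the slice satisfies `∫ |g(s)|² dμ ≤ M` and
`(∫ |g(s)|⁶ dμ)^{1/3} ≤ S(s)`, then for `2 ≤ r ≤ 6`, `0 < l` and `κ = 3l(r-2)/(4r) ≤ 1`
(equivalently `3/r + 2/l ≥ 3/2`),

  `∫ (∫ |g(s)|^r dμ)^{l/r} dν(s) ≤ M^{l/2-κ} · ν(univ)^{1-κ} · (∫ S dν)^κ`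

(Lebesgue interpolation `∫|f|^r ≤ (∫|f|²)^{(6-r)/4} (∫|f|⁶)^{(r-2)/4}` on each slice, then Hölder
in time); on the sharp line `3/r + 2/l = 3/2`, i.e. `κ = 1`, this reads `≤ M^{l/2-1} ∫ S dν`. The
Sobolev input `S = C_S² ∫|∇g(s)|²`, `C_S = SNormLESNormFDerivOfEqConst ℝ volume 2`, is supplied
for `C¹` slices in `L²(ℝ³)` (the tree's GNS inequality without compact support,
`eLpNorm_six_le_eLpNorm_fderiv_two`) and for slices with a WEAK gradient on `ℝ³`
(`eLpNorm_le_eLpNorm_weakFDeriv_of_eq`). In N–U's normalisation (`ν(univ) = |I| = θR²`,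
`M, ∫ S ≤ C_S² ‖vζ‖²_𝒱`) this is (3.5) with the factor `R^{2(1-κ)/l} = R^{3/r+2/l-3/2}`.

* general measure spaces (any index / space / value types):
  `lintegral_enorm_rpow_le_interpolation_two_six` (slice interpolation),
  `lintegral_enorm_rpow_rpow_le_interpolation_two_six` (the same in mixed exponents),
  `lintegral_mixedNorm_rpow_le_of_slice_bounds`, `lintegral_mixedNorm_rpow_le_of_slice_bounds_sharp`;
* Sobolev slice bounds on `ℝ³`-like spaces: `ae_sobolev_six_slice_bound_of_contDiff`,
  `ae_sobolev_six_slice_bound_of_hasWeakFDerivOn`;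
* registered forms on `ℝ × ℝ³`, scalar slices: `parabolicEmbedding_of_slice_bounds`,
  `parabolicEmbedding_of_contDiff`, `parabolicEmbedding_of_hasWeakFDerivOn`,
  `parabolicEmbedding_sharp_of_contDiff`.

## References

* A. I. Nazarov, N. N. Uraltseva, St. Petersburg Math. J. 23 (2012) 93–115 = arXiv:1011.1888,
  §1 (the class `𝒱`), Lemma 3.1, (3.4)–(3.5), (3.7), Remark 5. [NazarovUraltseva2012]
* O. A. Ladyzhenskaya, V. A. Solonnikov, N. N. Uraltseva, *Linear and quasilinear equations of
  parabolic type*, AMS (1968), Ch. II, §3, (3.4) (`V₂(Q_T) ⊂ L_{q,r}(Q_T)`).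
  [LadyzhenskayaSolonnikovUraltseva1968]
* G. Seregin, Anal. Math. Phys. 10 (2020), Paper 46 = arXiv:2006.04140, Lemma 2.2. [Seregin2020]
* Z. Lei, Q. S. Zhang, J. Funct. Anal. 261 (2011) = arXiv:1011.5066, §2 (the `(10/3,10/3)` model).
  [LeiZhang2011]
-/

-- the problem directory repeats the summit name (D-0017); core's `dupNamespace` linter fires
set_option linter.dupNamespace false

noncomputable section

open MeasureTheory Set Function Filter Module
open scoped NNReal ENNReal

namespace Summit.NavierStokesRegularity.NavierStokesRegularity.Theorems.AxisymmetricKatoGlobal.EulerScaling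

open Literature.Analysis.FluidPDE

/-! ### Lebesgue interpolation on a slice -/

/-- **Lebesgue interpolation between `L²` and `L⁶`**: for `2 ≤ r ≤ 6`,
`∫ |f|^r ≤ (∫ |f|²)^{(6-r)/4} (∫ |f|⁶)^{(r-2)/4}` (Hölder with the two exponents `(6-r)/4 + (r-2)/4 = 1`
applied to `|f|^r = (|f|²)^{(6-r)/4} (|f|⁶)^{(r-2)/4}`; the endpoints are equalities). [folklore] -/
theorem lintegral_enorm_rpow_le_interpolation_two_six {X β : Type*} [MeasurableSpace X] [ENorm β]
    (μ : Measure X) {f : X → β} (hf : AEMeasurable (fun x => ‖f x‖ₑ) μ) {r : ℝ} (hr : 2 ≤ r)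
    (hr6 : r ≤ 6) :
    ∫⁻ x, ‖f x‖ₑ ^ r ∂μ ≤
      (∫⁻ x, ‖f x‖ₑ ^ 2 ∂μ) ^ ((6 - r) / 4) * (∫⁻ x, ‖f x‖ₑ ^ (6 : ℝ) ∂μ) ^ ((r - 2) / 4) := by
  have hp : 0 ≤ (6 - r) / 4 := by linarith
  have hq : 0 ≤ (r - 2) / 4 := by linarith
  have key : ∫⁻ x, (‖f x‖ₑ ^ 2) ^ ((6 - r) / 4) * (‖f x‖ₑ ^ (6 : ℝ)) ^ ((r - 2) / 4) ∂μ ≤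
      (∫⁻ x, ‖f x‖ₑ ^ 2 ∂μ) ^ ((6 - r) / 4) * (∫⁻ x, ‖f x‖ₑ ^ (6 : ℝ) ∂μ) ^ ((r - 2) / 4) :=
    ENNReal.lintegral_mul_norm_pow_le (hf.pow_const 2) (hf.pow_const (6 : ℝ)) hp hq (by ring)
  refine le_trans (le_of_eq (lintegral_congr fun x => ?_)) key
  rw [← ENNReal.rpow_two, ← ENNReal.rpow_mul, ← ENNReal.rpow_mul,
    ← ENNReal.rpow_add_of_nonneg _ _ (mul_nonneg (by norm_num) hp) (mul_nonneg (by norm_num) hq)]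
  congr 1
  ring

/-- The slice interpolation in mixed-norm exponents: for `2 ≤ r ≤ 6`, `0 ≤ l` and
`κ = 3l(r-2)/(4r)`, `(∫ |f|^r)^{l/r} ≤ (∫ |f|²)^{l/2-κ} ((∫ |f|⁶)^{1/3})^κ`
(`(6-r)/4 · l/r = l/2 - κ`, `(r-2)/4 · l/r = κ/3`). [folklore] -/
theorem lintegral_enorm_rpow_rpow_le_interpolation_two_six {X β : Type*} [MeasurableSpace X]
    [ENorm β] (μ : Measure X) {f : X → β} (hf : AEMeasurable (fun x => ‖f x‖ₑ) μ) {r l κ : ℝ}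
    (hr : 2 ≤ r) (hr6 : r ≤ 6) (hl : 0 ≤ l) (hκ : κ = 3 * l * (r - 2) / (4 * r)) :
    (∫⁻ x, ‖f x‖ₑ ^ r ∂μ) ^ (l / r) ≤
      (∫⁻ x, ‖f x‖ₑ ^ 2 ∂μ) ^ (l / 2 - κ) *
        ((∫⁻ x, ‖f x‖ₑ ^ (6 : ℝ) ∂μ) ^ (1 / 3 : ℝ)) ^ κ := by
  have hr0 : r ≠ 0 := by positivity
  have hlr : 0 ≤ l / r := div_nonneg hl (by linarith)
  have e1 : (6 - r) / 4 * (l / r) = l / 2 - κ := by rw [hκ]; field_simp; ring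
  have e2 : (r - 2) / 4 * (l / r) = 1 / 3 * κ := by rw [hκ]; field_simp
  have h := ENNReal.rpow_le_rpow (lintegral_enorm_rpow_le_interpolation_two_six μ hf hr hr6) hlr
  rw [ENNReal.mul_rpow_of_nonneg _ _ hlr, ← ENNReal.rpow_mul, ← ENNReal.rpow_mul, e1, e2] at h
  rwa [← ENNReal.rpow_mul]

/-! ### The embedding from slice bounds, general measure spaces -/

/-- **`L^∞_t L²_x ∩ L²_t L⁶_x ⊂ L^l_t L^r_x` from slice bounds** (Nazarov–Uraltseva 2012, (3.5),
"by the embedding theorem [LSU], `‖vζ‖_{r,l,Q} ≤ C₉ R^{n/r+2/l-n/2} ‖vζ‖_𝒱`", `n = 3`, the Sobolev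
step abstracted into the slice bound `S`): if for `ν`-a.e. `s` the slice `g s` has
`∫ ‖g s‖ₑ² dμ ≤ M` and `(∫ ‖g s‖ₑ⁶ dμ)^{1/3} ≤ S s` (`S` a.e.-measurable), then for every
`2 ≤ r ≤ 6`, `0 < l` with `κ = 3l(r-2)/(4r) ≤ 1` (i.e. `3/r + 2/l ≥ 3/2`),
`∫ (∫ ‖g s‖ₑ^r dμ)^{l/r} dν ≤ M^{l/2-κ} · ν(univ)^{1-κ} · (∫ S dν)^κ`
(slice interpolation, then Hölder in time with exponents `1-κ`, `κ`). [cite: NazarovUraltseva2012, §3 (3.5)] -/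
theorem lintegral_mixedNorm_rpow_le_of_slice_bounds {ι X β : Type*} [MeasurableSpace ι]
    [MeasurableSpace X] [ENorm β] {ν : Measure ι} {μ : Measure X} {g : ι → X → β}
    (hmeas : ∀ᵐ s ∂ν, AEMeasurable (fun x => ‖g s x‖ₑ) μ)
    {M : ℝ≥0∞} (hM : ∀ᵐ s ∂ν, ∫⁻ x, ‖g s x‖ₑ ^ 2 ∂μ ≤ M)
    {S : ι → ℝ≥0∞} (hSm : AEMeasurable S ν)
    (hS : ∀ᵐ s ∂ν, (∫⁻ x, ‖g s x‖ₑ ^ (6 : ℝ) ∂μ) ^ (1 / 3 : ℝ) ≤ S s)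
    {r l κ : ℝ} (hr : 2 ≤ r) (hr6 : r ≤ 6) (hl : 0 < l) (hκ : κ = 3 * l * (r - 2) / (4 * r))
    (hκ1 : κ ≤ 1) :
    ∫⁻ s, (∫⁻ x, ‖g s x‖ₑ ^ r ∂μ) ^ (l / r) ∂ν ≤
      M ^ (l / 2 - κ) * ν univ ^ (1 - κ) * (∫⁻ s, S s ∂ν) ^ κ := by
  have hκ0 : 0 ≤ κ := by
    rw [hκ]
    exact div_nonneg (mul_nonneg (mul_nonneg (by norm_num) hl.le) (by linarith)) (by linarith)
  have hexp : 0 ≤ l / 2 - κ := by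
    have e1 : l / 2 - κ = (6 - r) / 4 * (l / r) := by
      have hr0 : r ≠ 0 := by positivity
      rw [hκ]; field_simp; ring
    rw [e1]
    exact mul_nonneg (by linarith) (div_nonneg hl.le (by linarith))
  -- the slice bound, a.e. in time
  have hslice : ∀ᵐ s ∂ν, (∫⁻ x, ‖g s x‖ₑ ^ r ∂μ) ^ (l / r) ≤ M ^ (l / 2 - κ) * S s ^ κ := by
    filter_upwards [hmeas, hM, hS] with s hms hMs hSs
    calc (∫⁻ x, ‖g s x‖ₑ ^ r ∂μ) ^ (l / r)
        ≤ (∫⁻ x, ‖g s x‖ₑ ^ 2 ∂μ) ^ (l / 2 - κ) *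
            ((∫⁻ x, ‖g s x‖ₑ ^ (6 : ℝ) ∂μ) ^ (1 / 3 : ℝ)) ^ κ :=
          lintegral_enorm_rpow_rpow_le_interpolation_two_six μ hms hr hr6 hl.le hκ
      _ ≤ M ^ (l / 2 - κ) * S s ^ κ :=
          mul_le_mul' (ENNReal.rpow_le_rpow hMs hexp) (ENNReal.rpow_le_rpow hSs hκ0)
  -- Hölder in time
  have hHolder : ∫⁻ s, S s ^ κ ∂ν ≤ ν univ ^ (1 - κ) * (∫⁻ s, S s ∂ν) ^ κ := by
    calc ∫⁻ s, S s ^ κ ∂ν = ∫⁻ s, (1 : ℝ≥0∞) ^ (1 - κ) * S s ^ κ ∂ν := by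
          simp only [ENNReal.one_rpow, one_mul]
      _ ≤ (∫⁻ _s, (1 : ℝ≥0∞) ∂ν) ^ (1 - κ) * (∫⁻ s, S s ∂ν) ^ κ :=
          ENNReal.lintegral_mul_norm_pow_le aemeasurable_const hSm (by linarith) hκ0 (by ring)
      _ = ν univ ^ (1 - κ) * (∫⁻ s, S s ∂ν) ^ κ := by rw [lintegral_one]
  calc ∫⁻ s, (∫⁻ x, ‖g s x‖ₑ ^ r ∂μ) ^ (l / r) ∂ν
      ≤ ∫⁻ s, M ^ (l / 2 - κ) * S s ^ κ ∂ν := lintegral_mono_ae hslice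
    _ = M ^ (l / 2 - κ) * ∫⁻ s, S s ^ κ ∂ν := lintegral_const_mul'' _ (hSm.pow_const κ)
    _ ≤ M ^ (l / 2 - κ) * (ν univ ^ (1 - κ) * (∫⁻ s, S s ∂ν) ^ κ) :=
        mul_le_mul_right hHolder _
    _ = M ^ (l / 2 - κ) * ν univ ^ (1 - κ) * (∫⁻ s, S s ∂ν) ^ κ := (mul_assoc _ _ _).symm

/-- **The sharp line `3/r + 2/l = 3/2`** (`2 ≤ l`, hence `2 < r ≤ 6`, `κ = 1`): under the slice
bounds `∫ ‖g s‖ₑ² ≤ M`, `(∫ ‖g s‖ₑ⁶)^{1/3} ≤ S s` for `ν`-a.e. `s`,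
`∫ (∫ ‖g s‖ₑ^r dμ)^{l/r} dν ≤ M^{l/2-1} ∫ S dν` — the scale-invariant parabolic embedding
`L^∞_t L²_x ∩ L²_t L⁶_x ⊂ L^l_t L^r_x`; `(r, l) = (10/3, 10/3)` is the tree's
`LeiZhang2011.lintegral_rpow_tenThirds_le_of_slice_bounds`, `(6, 2)` is the hypothesis itself. [cite: NazarovUraltseva2012, §3 (3.5) and (3.7)] -/
theorem lintegral_mixedNorm_rpow_le_of_slice_bounds_sharp {ι X β : Type*} [MeasurableSpace ι]
    [MeasurableSpace X] [ENorm β] {ν : Measure ι} {μ : Measure X} {g : ι → X → β}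
    (hmeas : ∀ᵐ s ∂ν, AEMeasurable (fun x => ‖g s x‖ₑ) μ)
    {M : ℝ≥0∞} (hM : ∀ᵐ s ∂ν, ∫⁻ x, ‖g s x‖ₑ ^ 2 ∂μ ≤ M)
    {S : ι → ℝ≥0∞} (hSm : AEMeasurable S ν)
    (hS : ∀ᵐ s ∂ν, (∫⁻ x, ‖g s x‖ₑ ^ (6 : ℝ) ∂μ) ^ (1 / 3 : ℝ) ≤ S s)
    {r l : ℝ} (hl : 2 ≤ l) (hrl : 3 / r + 2 / l = 3 / 2) :
    ∫⁻ s, (∫⁻ x, ‖g s x‖ₑ ^ r ∂μ) ^ (l / r) ∂ν ≤ M ^ (l / 2 - 1) * ∫⁻ s, S s ∂ν := by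
  have hl0 : 0 < l := by linarith
  have h2l : 2 / l ≤ 1 := by rw [div_le_one hl0]; exact hl
  have h3r : 3 / r = 3 / 2 - 2 / l := by linarith
  have hr0 : 0 < r := by
    by_contra h
    have : 3 / r ≤ 0 := div_nonpos_of_nonneg_of_nonpos (by norm_num) (not_lt.1 h)
    linarith
  have hr : 2 ≤ r := by
    have h2l0 : 0 < 2 / l := by positivity
    have h1 : 3 / r < 3 / 2 := by linarith
    rw [div_lt_div_iff_of_pos_left (by norm_num) hr0 (by norm_num)] at h1
    exact h1.le
  have hr6 : r ≤ 6 := by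
    have h1 : 3 / (6 : ℝ) ≤ 3 / r := by linarith
    exact (div_le_div_iff_of_pos_left (by norm_num) (by norm_num) hr0).1 h1
  have hκ : (1 : ℝ) = 3 * l * (r - 2) / (4 * r) := by
    have hr0' : r ≠ 0 := hr0.ne'
    have hl0' : l ≠ 0 := hl0.ne'
    field_simp
    field_simp at hrl
    linarith
  have h := lintegral_mixedNorm_rpow_le_of_slice_bounds hmeas hM hSm hS hr hr6 hl0 hκ le_rfl
  simpa only [sub_self, ENNReal.rpow_zero, mul_one, ENNReal.rpow_one] using h

/-! ### The Sobolev slice bounds on `ℝ³` -/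

/-- `(∫ ‖u‖ₑ⁶)^{1/3} = ‖u‖_{L⁶}²` for any `ENorm`-valued `u` (the tree's
`LeiZhang2011.lintegral_enorm_rpow_six_rpow_third` is the real-valued case). [folklore] -/
theorem lintegral_enorm_rpow_six_rpow_third_eq_sq {α ε : Type*} [MeasurableSpace α] [ENorm ε]
    (μ : Measure α) (u : α → ε) :
    (∫⁻ x, ‖u x‖ₑ ^ (6 : ℝ) ∂μ) ^ (1 / 3 : ℝ) = eLpNorm u 6 μ ^ 2 := by
  rw [eLpNorm_eq_lintegral_rpow_enorm_toReal (by norm_num) (by norm_num)]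
  simp only [ENNReal.toReal_ofNat]
  rw [← ENNReal.rpow_natCast, ← ENNReal.rpow_mul]
  norm_num

section Sobolev

variable {ι : Type*} [MeasurableSpace ι] {ν : Measure ι}
variable {E : Type*} [NormedAddCommGroup E] [InnerProductSpace ℝ E] [FiniteDimensional ℝ E]
  [MeasurableSpace E] [BorelSpace E]
variable {F : Type*} [NormedAddCommGroup F] [NormedSpace ℝ F] [FiniteDimensional ℝ F]

/-- **Sobolev slice bound, `C¹` slices**: on a `3`-dimensional inner product space with an additive
Haar measure `μ`, if for `ν`-a.e. `s` the slice `g s` is `C¹` with `g s ∈ L²(μ)` and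
`∫ ‖D(g s)‖ₑ² dμ ≤ W s`, then `(∫ ‖g s‖ₑ⁶ dμ)^{1/3} ≤ C_S² W s` for `ν`-a.e. `s`,
`C_S = SNormLESNormFDerivOfEqConst F μ 2` (the tree's GNS inequality without compact support,
`eLpNorm_six_le_eLpNorm_fderiv_two`, squared). [folklore] -/
theorem ae_sobolev_six_slice_bound_of_contDiff (μ : Measure E) [μ.IsAddHaarMeasure]
    (hE : finrank ℝ E = 3) {g : ι → E → F} (hg : ∀ᵐ s ∂ν, ContDiff ℝ 1 (g s))
    (hg2 : ∀ᵐ s ∂ν, eLpNorm (g s) 2 μ < ∞) {W : ι → ℝ≥0∞}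
    (hW : ∀ᵐ s ∂ν, ∫⁻ x, ‖fderiv ℝ (g s) x‖ₑ ^ 2 ∂μ ≤ W s) :
    ∀ᵐ s ∂ν, (∫⁻ x, ‖g s x‖ₑ ^ (6 : ℝ) ∂μ) ^ (1 / 3 : ℝ) ≤
      (SNormLESNormFDerivOfEqConst F μ 2 : ℝ≥0∞) ^ 2 * W s := by
  filter_upwards [hg, hg2, hW] with s hgs hg2s hWs
  rw [lintegral_enorm_rpow_six_rpow_third_eq_sq]
  calc eLpNorm (g s) 6 μ ^ 2
      ≤ (SNormLESNormFDerivOfEqConst F μ 2 * eLpNorm (fderiv ℝ (g s)) 2 μ) ^ 2 :=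
        pow_le_pow_left' (eLpNorm_six_le_eLpNorm_fderiv_two μ hE hgs hg2s) 2
    _ = (SNormLESNormFDerivOfEqConst F μ 2 : ℝ≥0∞) ^ 2 * ∫⁻ x, ‖fderiv ℝ (g s) x‖ₑ ^ 2 ∂μ := by
        rw [mul_pow, LeiZhang2011.eLpNorm_two_sq_eq_lintegral]
    _ ≤ _ := mul_le_mul_right hWs _

/-- **Sobolev slice bound, weakly differentiable slices**: on a `3`-dimensional inner product space
with its Lebesgue measure, if for `ν`-a.e. `s` the slice `g s ∈ L²` has the weak derivative `G s`
on the whole space (accepted `FunctionSpaces.HasWeakFDerivOn ⊤ volume`) with `∫ ‖G s‖ₑ² ≤ W s`,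
then `(∫ ‖g s‖ₑ⁶)^{1/3} ≤ C_S² W s` for `ν`-a.e. `s`, `C_S = SNormLESNormFDerivOfEqConst F volume 2`
(the tree's GNS inequality for weak derivatives, `eLpNorm_le_eLpNorm_weakFDeriv_of_eq`). [folklore] -/
theorem ae_sobolev_six_slice_bound_of_hasWeakFDerivOn (hE : finrank ℝ E = 3) {g : ι → E → F}
    {G : ι → E → E →L[ℝ] F}
    (hw : ∀ᵐ s ∂ν, Literature.Analysis.FunctionSpaces.HasWeakFDerivOn (⊤ : TopologicalSpace.Opens E) volume (g s)
      (G s))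
    (hg2 : ∀ᵐ s ∂ν, eLpNorm (g s) 2 volume < ∞) {W : ι → ℝ≥0∞}
    (hW : ∀ᵐ s ∂ν, ∫⁻ x, ‖G s x‖ₑ ^ 2 ≤ W s) :
    ∀ᵐ s ∂ν, (∫⁻ x, ‖g s x‖ₑ ^ (6 : ℝ)) ^ (1 / 3 : ℝ) ≤
      (SNormLESNormFDerivOfEqConst F (volume : Measure E) 2 : ℝ≥0∞) ^ 2 * W s := by
  filter_upwards [hw, hg2, hW] with s hws hg2s hWs
  rw [lintegral_enorm_rpow_six_rpow_third_eq_sq]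
  have h := eLpNorm_le_eLpNorm_weakFDeriv_of_eq hws (p := 2) (p' := 6) one_le_two (by omega)
    (by rw [hE]; norm_num) (by exact_mod_cast hg2s)
  have h' : eLpNorm (g s) 6 volume ≤
      SNormLESNormFDerivOfEqConst F (volume : Measure E) 2 * eLpNorm (G s) 2 volume := by
    exact_mod_cast h
  calc eLpNorm (g s) 6 volume ^ 2
      ≤ (SNormLESNormFDerivOfEqConst F (volume : Measure E) 2 * eLpNorm (G s) 2 volume) ^ 2 :=
        pow_le_pow_left' h' 2
    _ = (SNormLESNormFDerivOfEqConst F (volume : Measure E) 2 : ℝ≥0∞) ^ 2 *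
          ∫⁻ x, ‖G s x‖ₑ ^ 2 := by
        rw [mul_pow, LeiZhang2011.eLpNorm_two_sq_eq_lintegral]
    _ ≤ _ := mul_le_mul_right hWs _

end Sobolev

/-! ### Registered forms on `ℝ × ℝ³`, scalar slices -/

/-- **Mixed-norm parabolic embedding of the energy class from slice bounds, `ℝ × ℝ³`, scalar**
(Nazarov–Uraltseva 2012, (3.5) with `n = 3`, the Sobolev step abstracted into `S`): for a time
measure `ν` on `ℝ`, a space measure `μ` on `ℝ³` (e.g. the restrictions of Lebesgue measure to
`]t₀ - θR², t₀[` and to `B_{λR}`), a scalar `g` with a.e.-strongly measurable slices,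
`∫ |g s|² dμ ≤ M` and `(∫ |g s|⁶ dμ)^{1/3} ≤ S s` for `ν`-a.e. `s`: for all `2 ≤ r ≤ 6`, `0 < l`,
`κ = 3l(r-2)/(4r) ≤ 1`, `∫ (∫ |g s|^r dμ)^{l/r} dν ≤ M^{l/2-κ} ν(univ)^{1-κ} (∫ S dν)^κ`. [cite: NazarovUraltseva2012, §3 (3.5)] -/
theorem parabolicEmbedding_of_slice_bounds : ∀ (ν : Measure ℝ)
    (μ : Measure (EuclideanSpace ℝ (Fin 3))) (g : ℝ → EuclideanSpace ℝ (Fin 3) → ℝ) (M : ℝ≥0∞)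
    (S : ℝ → ℝ≥0∞) (r l κ : ℝ),
    (∀ᵐ s ∂ν, AEStronglyMeasurable (g s) μ) →
    (∀ᵐ s ∂ν, ∫⁻ x, ‖g s x‖ₑ ^ 2 ∂μ ≤ M) →
    AEMeasurable S ν →
    (∀ᵐ s ∂ν, (∫⁻ x, ‖g s x‖ₑ ^ (6 : ℝ) ∂μ) ^ (1 / 3 : ℝ) ≤ S s) →
    2 ≤ r → r ≤ 6 → 0 < l → κ = 3 * l * (r - 2) / (4 * r) → κ ≤ 1 →
    ∫⁻ s, (∫⁻ x, ‖g s x‖ₑ ^ r ∂μ) ^ (l / r) ∂ν ≤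
      M ^ (l / 2 - κ) * ν univ ^ (1 - κ) * (∫⁻ s, S s ∂ν) ^ κ := by
  intro ν μ g M S r l κ hmeas hM hSm hS hr hr6 hl hκ hκ1
  exact lintegral_mixedNorm_rpow_le_of_slice_bounds (hmeas.mono fun s hs => hs.enorm) hM hSm hS
    hr hr6 hl hκ hκ1

/-- **Mixed-norm parabolic embedding of the energy class, `C¹` slices on `ℝ³`**
(Nazarov–Uraltseva 2012, (3.5), `n = 3`: `‖vζ‖_{r,l,Q} ≤ C R^{3/r+2/l-3/2}‖vζ‖_𝒱` for
`3/2 ≤ 3/r + 2/l`): if for `ν`-a.e. `s` the slice `g s` is `C¹`, in `L²(ℝ³)`, with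
`∫ |g s|² ≤ M` and `∫ ‖D(g s)‖² ≤ W s` (`W` a.e.-measurable), then for `2 ≤ r ≤ 6`, `0 < l`,
`κ = 3l(r-2)/(4r) ≤ 1`:
`∫ (∫ |g s|^r)^{l/r} dν ≤ M^{l/2-κ} ν(univ)^{1-κ} (C_S² ∫ W dν)^κ`,
`C_S = SNormLESNormFDerivOfEqConst ℝ volume 2`. [cite: NazarovUraltseva2012, §3 (3.5)] -/
theorem parabolicEmbedding_of_contDiff : ∀ (ν : Measure ℝ) (g : ℝ → EuclideanSpace ℝ (Fin 3) → ℝ)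
    (M : ℝ≥0∞) (W : ℝ → ℝ≥0∞) (r l κ : ℝ),
    (∀ᵐ s ∂ν, ContDiff ℝ 1 (g s)) →
    (∀ᵐ s ∂ν, eLpNorm (g s) 2 (volume : Measure (EuclideanSpace ℝ (Fin 3))) < ∞) →
    (∀ᵐ s ∂ν, ∫⁻ x, ‖g s x‖ₑ ^ 2 ≤ M) →
    AEMeasurable W ν →
    (∀ᵐ s ∂ν, ∫⁻ x, ‖fderiv ℝ (g s) x‖ₑ ^ 2 ≤ W s) →
    2 ≤ r → r ≤ 6 → 0 < l → κ = 3 * l * (r - 2) / (4 * r) → κ ≤ 1 →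
    ∫⁻ s, (∫⁻ x, ‖g s x‖ₑ ^ r) ^ (l / r) ∂ν ≤
      M ^ (l / 2 - κ) * ν univ ^ (1 - κ) *
        ((SNormLESNormFDerivOfEqConst ℝ (volume : Measure (EuclideanSpace ℝ (Fin 3))) 2 : ℝ≥0∞)
            ^ 2 * ∫⁻ s, W s ∂ν) ^ κ := by
  intro ν g M W r l κ hg hg2 hM hWm hW hr hr6 hl hκ hκ1
  have hmeas : ∀ᵐ s ∂ν, AEMeasurable (fun x => ‖g s x‖ₑ)
      (volume : Measure (EuclideanSpace ℝ (Fin 3))) :=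
    hg.mono fun s hs => hs.continuous.aestronglyMeasurable.enorm
  have hS := ae_sobolev_six_slice_bound_of_contDiff (volume : Measure (EuclideanSpace ℝ (Fin 3)))
    (finrank_euclideanSpace_fin (𝕜 := ℝ) (n := 3)) hg hg2 hW
  have h := lintegral_mixedNorm_rpow_le_of_slice_bounds hmeas hM (hWm.const_mul _) hS hr hr6 hl
    hκ hκ1
  rwa [lintegral_const_mul'' _ hWm] at h

/-- **Mixed-norm parabolic embedding of the energy class, weakly differentiable slices on `ℝ³`**
(Nazarov–Uraltseva 2012, (3.5), `n = 3`, for the class `𝒱` of weak solutions, §1): if for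
`ν`-a.e. `s` the slice `g s ∈ L²(ℝ³)` has the weak derivative `G s` on `ℝ³` with
`∫ |g s|² ≤ M`, `∫ ‖G s‖² ≤ W s` (`W` a.e.-measurable), then for `2 ≤ r ≤ 6`, `0 < l`,
`κ = 3l(r-2)/(4r) ≤ 1`:
`∫ (∫ |g s|^r)^{l/r} dν ≤ M^{l/2-κ} ν(univ)^{1-κ} (C_S² ∫ W dν)^κ`. [cite: NazarovUraltseva2012, §3 (3.5)] -/
theorem parabolicEmbedding_of_hasWeakFDerivOn : ∀ (ν : Measure ℝ)
    (g : ℝ → EuclideanSpace ℝ (Fin 3) → ℝ)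
    (G : ℝ → EuclideanSpace ℝ (Fin 3) → EuclideanSpace ℝ (Fin 3) →L[ℝ] ℝ)
    (M : ℝ≥0∞) (W : ℝ → ℝ≥0∞) (r l κ : ℝ),
    (∀ᵐ s ∂ν, Literature.Analysis.FunctionSpaces.HasWeakFDerivOn
      (⊤ : TopologicalSpace.Opens (EuclideanSpace ℝ (Fin 3))) volume (g s) (G s)) →
    (∀ᵐ s ∂ν, eLpNorm (g s) 2 (volume : Measure (EuclideanSpace ℝ (Fin 3))) < ∞) →
    (∀ᵐ s ∂ν, ∫⁻ x, ‖g s x‖ₑ ^ 2 ≤ M) →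
    AEMeasurable W ν →
    (∀ᵐ s ∂ν, ∫⁻ x, ‖G s x‖ₑ ^ 2 ≤ W s) →
    2 ≤ r → r ≤ 6 → 0 < l → κ = 3 * l * (r - 2) / (4 * r) → κ ≤ 1 →
    ∫⁻ s, (∫⁻ x, ‖g s x‖ₑ ^ r) ^ (l / r) ∂ν ≤
      M ^ (l / 2 - κ) * ν univ ^ (1 - κ) *
        ((SNormLESNormFDerivOfEqConst ℝ (volume : Measure (EuclideanSpace ℝ (Fin 3))) 2 : ℝ≥0∞)
            ^ 2 * ∫⁻ s, W s ∂ν) ^ κ := by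
  intro ν g G M W r l κ hw hg2 hM hWm hW hr hr6 hl hκ hκ1
  have hmeas : ∀ᵐ s ∂ν, AEMeasurable (fun x => ‖g s x‖ₑ)
      (volume : Measure (EuclideanSpace ℝ (Fin 3))) := by
    filter_upwards [hw] with s hs
    have hloc : LocallyIntegrable (g s) (volume : Measure (EuclideanSpace ℝ (Fin 3))) :=
      locallyIntegrableOn_univ.1 (by
        simpa only [TopologicalSpace.Opens.coe_top] using hs.locallyIntegrableOn)
    exact hloc.aestronglyMeasurable.enorm
  have hS := ae_sobolev_six_slice_bound_of_hasWeakFDerivOn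
    (finrank_euclideanSpace_fin (𝕜 := ℝ) (n := 3)) hw hg2 hW
  have h := lintegral_mixedNorm_rpow_le_of_slice_bounds hmeas hM (hWm.const_mul _) hS hr hr6 hl
    hκ hκ1
  rwa [lintegral_const_mul'' _ hWm] at h

/-- **The sharp line, `C¹` slices on `ℝ³`**: for `2 ≤ l` and `3/r + 2/l = 3/2`, under the
hypotheses of `parabolicEmbedding_of_contDiff`,
`∫ (∫ |g s|^r)^{l/r} dν ≤ C_S² M^{l/2-1} ∫ W dν` — the scale-invariant embedding
`L^∞_t L²_x ∩ L²_t Ḣ¹_x(ℝ³) ⊂ L^l_t L^r_x`, of which the tree's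
`LeiZhang2011.lintegral_rpow_tenThirds_le_of_slice_bounds` is `(r, l) = (10/3, 10/3)`
(N–U (3.7), the exponent of the Moser iteration). [cite: NazarovUraltseva2012, §3 (3.5) and (3.7)] -/
theorem parabolicEmbedding_sharp_of_contDiff : ∀ (ν : Measure ℝ)
    (g : ℝ → EuclideanSpace ℝ (Fin 3) → ℝ) (M : ℝ≥0∞) (W : ℝ → ℝ≥0∞) (r l : ℝ),
    (∀ᵐ s ∂ν, ContDiff ℝ 1 (g s)) →
    (∀ᵐ s ∂ν, eLpNorm (g s) 2 (volume : Measure (EuclideanSpace ℝ (Fin 3))) < ∞) →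
    (∀ᵐ s ∂ν, ∫⁻ x, ‖g s x‖ₑ ^ 2 ≤ M) →
    AEMeasurable W ν →
    (∀ᵐ s ∂ν, ∫⁻ x, ‖fderiv ℝ (g s) x‖ₑ ^ 2 ≤ W s) →
    2 ≤ l → 3 / r + 2 / l = 3 / 2 →
    ∫⁻ s, (∫⁻ x, ‖g s x‖ₑ ^ r) ^ (l / r) ∂ν ≤
      (SNormLESNormFDerivOfEqConst ℝ (volume : Measure (EuclideanSpace ℝ (Fin 3))) 2 : ℝ≥0∞) ^ 2 *
        M ^ (l / 2 - 1) * ∫⁻ s, W s ∂ν := by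
  intro ν g M W r l hg hg2 hM hWm hW hl hrl
  have hmeas : ∀ᵐ s ∂ν, AEMeasurable (fun x => ‖g s x‖ₑ)
      (volume : Measure (EuclideanSpace ℝ (Fin 3))) :=
    hg.mono fun s hs => hs.continuous.aestronglyMeasurable.enorm
  have hS := ae_sobolev_six_slice_bound_of_contDiff (volume : Measure (EuclideanSpace ℝ (Fin 3)))
    (finrank_euclideanSpace_fin (𝕜 := ℝ) (n := 3)) hg hg2 hW
  have h := lintegral_mixedNorm_rpow_le_of_slice_bounds_sharp hmeas hM (hWm.const_mul _) hS hl hrl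
  rw [lintegral_const_mul'' _ hWm] at h
  calc _ ≤ _ := h
    _ = _ := by ring

end Summit.NavierStokesRegularity.NavierStokesRegularity.Theorems.AxisymmetricKatoGlobal.EulerScaling

end
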